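import Summits.QuantumFields.YangMills.Theorems.PencilRigidityHypercubicLimitDefs
import Summits.QuantumFields.YangMills.Theorems.PencilRigidityHypercubicLimitSoftScheme
import Summits.QuantumFields.YangMills.Theorems.PencilRigidityHypercubicLimitSoftWitnessU
import Summits.QuantumFields.YangMills.Theorems.PencilRigidityHypercubicLimitNonGaussianLeg
import Summits.QuantumFields.YangMills.Theorems.PencilRigidityHypercubicLimitTwoPointNontrivialLeg
import Summits.QuantumFields.YangMills.Theorems.PencilRigidityHypercubicLimitScaledQ2LowerBound
import Summits.QuantumFields.YangMills.Theorems.PencilRigidityHypercubicLimitLatticeGapBridge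
import HarnessLib

/-!
# Crux `HypercubicLimit` (stmt-QuantumFields-8646), line `conditional-mean-telescoping`: registered sub-goal `stub_softLegsU`

Support file (`--supports stmt-QuantumFields-8646`, c2 seat, reshape 3): **leg (S) of the closure** —
`UniformBound → WindowRegularity → NonGaussianFloor → SoftLegsP` (here with `SoftLegsP`/`PolyRenorm` unfolded).  Constants: `δ₀ := s₁` (the scale of the (NG) floor,
so that the floor's RP square IS the normalisation square `N`); (W2) at `c₀ = δ₀` (doubling + floor give `C > 0`,
`N ≥ a^{p+q}/(C δ₀^p)`, hence `c = N^{-1/2} ≤ a^{-(p+q+1)}` once `a ≤ 1/(C δ₀^p + 1)` — the clause `PolyRenorm`; the cone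
feeds `scaledQ2_lower_bound`); the sequences of `softScheme`; the witness of `softWitnessU`; non-triviality by
`scaledQ2_lower_bound` + `twoPointNontrivial_of_scaledQ2`, non-Gaussianity by the (NG) floor +
`smearedThreePoint_eq_mul_Q3` + `nonGaussian_of_scaledQ3`, the uniform lattice gap at rate `1` by
`hasLatticeMassGap_of_allPairsDecay` (clause (ii) of the gap data, `a_k = m(β_k)`).
-/

set_option autoImplicit false

noncomputable section

open scoped SchwartzMap BigOperators
open MeasureTheory Filter Topology
open Literature.MathematicalPhysics.QuantumFieldTheory Literature.MathematicalPhysics.QuantumLattice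
open Literature.MathematicalPhysics.AQFT
open Literature.Probability.LatticeModels (box Site)
open Summit.QuantumFields.YangMills.Theorems.OSLegsFromFemtoAndGap
open Summit.QuantumFields.YangMills.Theorems.HypercubicLimit.Negative (rpSquare)
open Summit.QuantumFields.YangMills.Cruxes.OSLegsFromFemtoAndGap.DlrCollarTransfer (Q2 Q3)

namespace Summit.QuantumFields.YangMills.Cruxes.HypercubicLimit.ConditionalMeanTelescoping

/-- **The renormalisation constant is polynomial in `1/a`, one step**: from the (W2) doubling between `1` and
`R₀ = ⌊δ₀/a⌋₊` and the floor `a^q ≤ A(1)`, for `0 < a ≤ 1`, `a ≤ δ₀`, `a ≤ 1/(|C| δ₀^p + 1)`: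
`(√N)⁻¹ ≤ a^{-(p+q+1)}` with `N = A(R₀)`. -/
theorem inv_sqrt_refSquare_le {C δ₀ a A₁ N : ℝ} {p q : ℕ} (hδ₀ : 0 < δ₀) (ha : 0 < a) (ha1 : a ≤ 1)
    (haδ : a ≤ δ₀) (haC : a ≤ 1 / (|C| * δ₀ ^ p + 1)) (hfloor : a ^ q ≤ A₁)
    (hdoub : A₁ ≤ C * ((⌊δ₀ / a⌋₊ : ℝ) / 1) ^ p * N) (hN : 0 < N) :
    (Real.sqrt N)⁻¹ ≤ (a⁻¹) ^ (p + q + 1) := by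
  have haq : 0 < a ^ q := pow_pos ha q
  have hR₀1 : (1 : ℝ) ≤ ⌊δ₀ / a⌋₊ := by
    have : (1 : ℝ) ≤ δ₀ / a := by rw [le_div_iff₀ ha]; linarith
    exact_mod_cast Nat.le_floor (by exact_mod_cast this)
  have hR₀le : (⌊δ₀ / a⌋₊ : ℝ) ≤ δ₀ / a := Nat.floor_le (by positivity)
  have hR₀pos : (0 : ℝ) < ⌊δ₀ / a⌋₊ := by linarith
  rw [div_one] at hdoub
  -- `C > 0`
  have hC : 0 < C := by
    by_contra h
    push Not at h
    have : C * (⌊δ₀ / a⌋₊ : ℝ) ^ p * N ≤ 0 :=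
      mul_nonpos_of_nonpos_of_nonneg (mul_nonpos_of_nonpos_of_nonneg h (by positivity)) hN.le
    linarith
  have hCabs : |C| = C := abs_of_pos hC
  -- `a^{p+q} ≤ C δ₀^p N`
  have h1 : a ^ (p + q) ≤ C * δ₀ ^ p * N := by
    have h2 : a ^ q ≤ C * (δ₀ / a) ^ p * N := by
      refine (hfloor.trans hdoub).trans ?_
      gcongr
    have h3 : a ^ p * (C * (δ₀ / a) ^ p * N) = C * δ₀ ^ p * N := by
      rw [div_pow]; field_simp
    calc a ^ (p + q) = a ^ p * a ^ q := pow_add _ _ _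
      _ ≤ a ^ p * (C * (δ₀ / a) ^ p * N) := mul_le_mul_of_nonneg_left h2 (by positivity)
      _ = C * δ₀ ^ p * N := h3
  -- `a^{2(p+q+1)} ≤ N`
  have hCδ : 0 < C * δ₀ ^ p + 1 := by positivity
  have haC' : a * (C * δ₀ ^ p + 1) ≤ 1 := by
    rw [hCabs] at haC
    rwa [le_div_iff₀ hCδ] at haC
  have h4 : a ^ (2 * (p + q + 1)) ≤ N := by
    have h5 : a ^ (2 * (p + q + 1)) ≤ a ^ (p + q) * a := by
      rw [show 2 * (p + q + 1) = (p + q) + (p + q + 2) by ring, pow_add]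
      refine mul_le_mul_of_nonneg_left ?_ (by positivity)
      calc a ^ (p + q + 2) ≤ a ^ 1 := pow_le_pow_of_le_one ha.le ha1 (by omega)
        _ = a := pow_one a
    have h6 : a ^ (p + q) * a ≤ N := by
      have h7 : a ^ (p + q) * a * (C * δ₀ ^ p + 1) ≤ C * δ₀ ^ p * N * 1 := by
        calc a ^ (p + q) * a * (C * δ₀ ^ p + 1) = a ^ (p + q) * (a * (C * δ₀ ^ p + 1)) := by ring
          _ ≤ (C * δ₀ ^ p * N) * 1 := mul_le_mul h1 haC' (by positivity) (by positivity)
      nlinarith [mul_pos hC (pow_pos hδ₀ p), pow_pos ha (p + q)]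
    exact h5.trans h6
  -- conclude
  have h8 : a ^ (p + q + 1) ≤ Real.sqrt N := by
    rw [show a ^ (p + q + 1) = Real.sqrt ((a ^ (p + q + 1)) ^ 2) by rw [Real.sqrt_sq (by positivity)]]
    exact Real.sqrt_le_sqrt (by rw [← pow_mul, mul_comm]; exact h4)
  rw [inv_pow]
  exact inv_anti₀ (pow_pos ha _) h8

/-- **`stub_softLegsU`** (registered sub-goal of crux stmt-QuantumFields-8646, c2 seat): leg (S) of the closure with its target
`SoftLegsP` UNFOLDED (`PolyRenorm` unfolded too), so that the proof lands without the vocabulary file B; the registered stub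
`stub_softLegs : UniformBound → WindowRegularity → NonGaussianFloor → SoftLegsP` is then one line. -/
theorem stub_softLegsU : UniformBound → WindowRegularity → NonGaussianFloor →
    ∀ (G : Type) [Group G] [TopologicalSpace G] [IsTopologicalGroup G] [CompactSpace G]
      [MeasurableSpace G] [BorelSpace G], IsCompactSimpleLieGroup G →
      ∀ (r : LatticeRep G) (β₁ C₁ c₂ : ℝ) (m : ℝ → ℝ), GapData G r β₁ C₁ c₂ m →
        ∀ Λ : ℝ → ℕ → ℕ, ∃ (δ₀ : ℝ) (sch : SpeciesScheme (YMSpecies G)) (S₁ : SchwingerFamily (EuclideanSpace ℝ (Fin 4)))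
          (Spl : (n : ℕ) → (Fin n → Fin 4 × Fin 4) → (𝓢((Fin n → EuclideanSpace ℝ (Fin 4)), ℂ) →L[ℂ] ℂ)),
          0 < δ₀ ∧ SoftData r m δ₀ Λ sch S₁ Spl ∧ (∃ Q : ℕ, ∀ k, sch.c r.curvature k ≤ ((sch.a k)⁻¹) ^ Q) ∧
            SoftClauses r sch S₁ := by
  intro hU hW2 hNG G _ _ _ _ _ _ hG r β₁ C₁ c₂ m hgap Λ
  classical
  obtain ⟨hm_pos, hm_lim, hii, -, -⟩ := id hgap
  /- 1. constants -/
  obtain ⟨s₁, σ, c₁, βN, φ₁, φ₂, φ₃, hs₁, hσ, hc₁, hsupp₁, hsupp₂, hsupp₃, hd12, hd13, hd23, hNGfloor⟩ :=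
    hNG G hG r β₁ C₁ c₂ m hgap
  set δ₀ : ℝ := s₁ with hδ₀def
  have hδ₀ : 0 < δ₀ := hs₁
  obtain ⟨K, βU, γ, s, hUmain⟩ := hU G hG r β₁ C₁ c₂ m hgap δ₀ hδ₀
  obtain ⟨C, c, θ, βW, p, q, hc, hθ, hW2main⟩ := hW2 G hG r β₁ C₁ c₂ m hgap δ₀ hδ₀
  -- `K ≥ 0` may be assumed: `tⁿ ≤ |t|ⁿ`
  have hUabs : ∀ β : ℝ, βU ≤ β → ∀ n : ℕ, 2 ≤ n → ∃ S₀ : ℕ, ∀ S : ℕ, S₀ ≤ S →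
      0 < refSquare r β S δ₀ (m β) ∧
      ∀ (q : Fin n → Fin 4 × Fin 4), (∀ i, (q i).1 ≠ (q i).2) →
        ∀ (y : (Fin n → Site 4) → (Fin n → EuclideanSpace ℝ (Fin 4))),
          (∀ x l, ‖y x l - m β • siteToE (x l)‖ ≤ 6 * m β) →
          ∀ F : 𝓢((Fin n → EuclideanSpace ℝ (Fin 4)), ℂ), IsOffDiagonal F →
            m β ^ (4 * n) * ‖∑ x ∈ Fintype.piFinset (fun _ : Fin n => box 4 S),
                ((planeWeight r β S q x : ℝ) : ℂ) * F (y x)‖ ≤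
              (|K| * (n : ℝ) ^ γ * Real.sqrt (refSquare r β S δ₀ (m β))) ^ n * schwartzNorm (s * n) F := by
    intro β hβ n hn
    obtain ⟨S₀, hS₀⟩ := hUmain β hβ n hn
    refine ⟨S₀, fun S hS => ⟨(hS₀ S hS).1, fun q hq y hy F hF => ((hS₀ S hS).2 q hq y hy F hF).trans ?_⟩⟩
    refine mul_le_mul_of_nonneg_right ?_ (schwartzNorm_nonneg _ _)
    calc (K * (n : ℝ) ^ γ * Real.sqrt (refSquare r β S δ₀ (m β))) ^ n
        ≤ |(K * (n : ℝ) ^ γ * Real.sqrt (refSquare r β S δ₀ (m β))) ^ n| := le_abs_self _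
      _ = (|K| * (n : ℝ) ^ γ * Real.sqrt (refSquare r β S δ₀ (m β))) ^ n := by
          rw [abs_pow, abs_mul, abs_mul, abs_of_nonneg (by positivity : (0 : ℝ) ≤ (n : ℝ) ^ γ),
            abs_of_nonneg (Real.sqrt_nonneg _)]
  -- the lattice floor of non-triviality: one fixed positive-time bump
  obtain ⟨v, ε, a₅, Λ₅, hε, ha₅, hv, hQ2⟩ := scaledQ2_lower_bound δ₀ θ c |K| γ s hδ₀ hθ hc (abs_nonneg K)
  -- thresholds as functions
  choose! S₀N hS₀N using hNGfloor
  choose! S₀U hS₀U using hUabs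
  choose! S₀W hS₀W using hW2main
  /- 2. the sequences -/
  set a₀ : ℝ := min (1 / 24) (min a₅ (min δ₀ (1 / (|C| * δ₀ ^ p + 1)))) with ha₀def
  have ha₀ : 0 < a₀ := by
    have : 0 < 1 / (|C| * δ₀ ^ p + 1) := by positivity
    exact lt_min (by norm_num) (lt_min ha₅ (lt_min hδ₀ this))
  set βthr : ℝ := max βN (max βU βW) with hβthr
  set S₀ : ℝ → ℕ → ℕ := fun β n => max (S₀N β) (max (S₀U β n) (max (S₀U β 2) (S₀W β))) with hS₀def
  obtain ⟨βs, Ls, hthr, hβ₁, hβlim, hmpos, hma₀, hmlim, hΛ, hS₀, hLa, hΛ₀, hgrow⟩ :=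
    softScheme m β₁ hm_pos hm_lim βthr a₀ ha₀ Λ S₀ Λ₅
  have hβN : ∀ k, βN ≤ βs k := fun k => (le_max_left _ _).trans (hthr k)
  have hβU : ∀ k, βU ≤ βs k := fun k => ((le_max_left _ _).trans (le_max_right _ _)).trans (hthr k)
  have hβW : ∀ k, βW ≤ βs k := fun k => ((le_max_right _ _).trans (le_max_right _ _)).trans (hthr k)
  have hm24 : ∀ k, m (βs k) ≤ 1 / 24 := fun k => (hma₀ k).trans (min_le_left _ _)
  have hma₅ : ∀ k, m (βs k) ≤ a₅ := fun k => (hma₀ k).trans ((min_le_right _ _).trans (min_le_left _ _))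
  have hmδ₀ : ∀ k, m (βs k) ≤ δ₀ := fun k =>
    (hma₀ k).trans ((min_le_right _ _).trans ((min_le_right _ _).trans (min_le_left _ _)))
  have hmC : ∀ k, m (βs k) ≤ 1 / (|C| * δ₀ ^ p + 1) := fun k =>
    (hma₀ k).trans ((min_le_right _ _).trans ((min_le_right _ _).trans (min_le_right _ _)))
  have hm1 : ∀ k, m (βs k) ≤ 1 := fun k => (hm24 k).trans (by norm_num)
  -- torus thresholds served at every step
  have hLN : ∀ k, S₀N (βs k) ≤ Ls k := fun k => (le_max_left _ _).trans (hS₀ k 0 (Nat.zero_le _))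
  have hLU2 : ∀ k, S₀U (βs k) 2 ≤ Ls k := fun k =>
    ((le_max_left _ _).trans ((le_max_right _ _).trans (le_max_right _ _))).trans (hS₀ k 0 (Nat.zero_le _))
  have hLUn : ∀ k n : ℕ, n ≤ k → S₀U (βs k) n ≤ Ls k := fun k n hn =>
    ((le_max_left _ _).trans (le_max_right _ _)).trans (hS₀ k n hn)
  have hLW : ∀ k, S₀W (βs k) ≤ Ls k := fun k =>
    ((le_max_right _ _).trans ((le_max_right _ _).trans (le_max_right _ _))).trans (hS₀ k 0 (Nat.zero_le _))
  /- 3. per-step facts -/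
  have hNpos : ∀ k, 0 < refSquare r (βs k) (Ls k) δ₀ (m (βs k)) := fun k =>
    (hS₀U (βs k) (hβU k) 2 le_rfl (Ls k) (hLU2 k)).1
  have hW2k : ∀ k, (∀ R R' : ℕ, 1 ≤ R → R ≤ R' → (R' : ℝ) ≤ δ₀ / m (βs k) →
      rpSquare r (βs k) (Ls k) R ≤ C * ((R' : ℝ) / R) ^ p * rpSquare r (βs k) (Ls k) R') ∧
      (∀ (R : ℕ) (x y : Site 4), 1 ≤ R → (R : ℝ) ≤ δ₀ / m (βs k) →
        (R : ℝ) ≤ x 0 → (x 0 : ℝ) ≤ (1 + θ) * R → (R : ℝ) ≤ y 0 → (y 0 : ℝ) ≤ (1 + θ) * R →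
        (∀ i : Fin 4, i ≠ 0 → (|x i - y i| : ℝ) ≤ θ * R) →
          c * rpSquare r (βs k) (Ls k) R ≤ reflPair r (βs k) (Ls k) x y) ∧
      m (βs k) ^ q ≤ rpSquare r (βs k) (Ls k) 1 := fun k => hS₀W (βs k) (hβW k) (Ls k) (hLW k)
  have hR₀ : ∀ k, 1 ≤ ⌊δ₀ / m (βs k)⌋₊ := fun k =>
    Nat.le_floor (by rw [Nat.cast_one, le_div_iff₀ (hmpos k)]; linarith [hmδ₀ k])
  have hR₀le : ∀ k, (⌊δ₀ / m (βs k)⌋₊ : ℝ) ≤ δ₀ / m (βs k) := fun k =>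
    Nat.floor_le (div_nonneg hδ₀.le (hmpos k).le)
  have hNQ : ∀ k, (Real.sqrt (refSquare r (βs k) (Ls k) δ₀ (m (βs k))))⁻¹ ≤ ((m (βs k))⁻¹) ^ (p + q + 1) := by
    intro k
    obtain ⟨hdoub, -, hfloor⟩ := hW2k k
    have h1 := hdoub 1 ⌊δ₀ / m (βs k)⌋₊ le_rfl (hR₀ k) (hR₀le k)
    rw [Nat.cast_one] at h1
    exact inv_sqrt_refSquare_le hδ₀ (hmpos k) (hm1 k) (hmδ₀ k) (hmC k) hfloor h1 (hNpos k)
  have hUk : ∀ n : ℕ, 2 ≤ n → ∀ k : ℕ, n ≤ k → ∀ q : Fin n → Fin 4 × Fin 4, (∀ i, (q i).1 ≠ (q i).2) →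
      ∀ (y : (Fin n → Site 4) → (Fin n → EuclideanSpace ℝ (Fin 4))),
        (∀ x l, ‖y x l - m (βs k) • siteToE (x l)‖ ≤ 6 * m (βs k)) →
        ∀ F : 𝓢((Fin n → EuclideanSpace ℝ (Fin 4)), ℂ), IsOffDiagonal F →
          m (βs k) ^ (4 * n) * ‖∑ x ∈ Fintype.piFinset (fun _ : Fin n => box 4 (Ls k)),
              ((planeWeight r (βs k) (Ls k) q x : ℝ) : ℂ) * F (y x)‖ ≤
            (|K| * (n : ℝ) ^ γ * Real.sqrt (refSquare r (βs k) (Ls k) δ₀ (m (βs k)))) ^ n *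
              schwartzNorm (s * n) F :=
    fun n hn k hk => (hS₀U (βs k) (hβU k) n hn (Ls k) (hLUn k n hk)).2
  /- 4. the witness -/
  obtain ⟨φ, hφ, sch, S₁, Spl, hschβ, hschL, hscha, hschc, hSD, hPR, hE0, hE0', hE3, htrans, hconv⟩ :=
    softWitnessU G r m δ₀ Λ βs Ls |K| γ s (p + q + 1) (abs_nonneg K) hmpos hm24 hmlim hβlim hLa hgrow hΛ
      hNpos hNQ hUk
  obtain ⟨-, -, -, -, -, -, -, hD8, -, -, hS₁1, -, -, -⟩ := id hSD
  have hφk : ∀ k, k ≤ φ k := fun k => hφ.id_le k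
  have hca : ∀ k, sch.c r.curvature k * sch.a k ^ 4 =
      (Real.sqrt (refSquare r (βs (φ k)) (Ls (φ k)) δ₀ (m (βs (φ k)))))⁻¹ * m (βs (φ k)) ^ 4 := fun k => by
    rw [hschc, hscha]
  /- 5. non-triviality -/
  have hfloorQ2 : ∀ᶠ k in atTop, ε ≤ (sch.c r.curvature k * sch.a k ^ 4) ^ 2 *
      Q2 G r (sch.β k) (sch.L k) (sch.a k) (thetaTest 4 v) v := by
    filter_upwards [eventually_ge_atTop 2] with k hk
    have hk2 : 2 ≤ φ k := hk.trans (hφk k)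
    obtain ⟨-, hcone, -⟩ := hW2k (φ k)
    have h := hQ2 G r (βs (φ k)) (Ls (φ k)) (m (βs (φ k))) (hmpos _) (hma₅ _) (hΛ₀ _) (hNpos _)
      (fun x y hx1 hx2 hy1 hy2 hxy => hcone _ x y (hR₀ _) (hR₀le _) hx1 hx2 hy1 hy2 hxy)
      (fun q hq y hy F hF => by
        have := hUk 2 le_rfl (φ k) hk2 q hq y hy F hF
        simpa [refSquare] using this)
    rw [hca, hschβ, hschL, hscha, mul_pow, ← pow_mul, inv_pow, Real.sq_sqrt (hNpos _).le]
    simpa [mul_assoc, refSquare] using h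
  have hNT := twoPointNontrivial_of_scaledQ2 G r sch.β sch.L sch.a (sch.c r.curvature) S₁ v ε hε hv hS₁1
    (fun F hF => hD8 2 F hF) hfloorQ2
  /- 6. non-Gaussianity -/
  have hfloorQ3 : ∀ᶠ k in atTop, c₁ ≤ |(sch.c r.curvature k * sch.a k ^ 4) ^ 3 *
      Q3 G r (sch.β k) (sch.L k) (sch.a k) φ₁ φ₂ φ₃| := by
    refine Eventually.of_forall fun k => ?_
    have hfl := hS₀N (βs (φ k)) (hβN _) (Ls (φ k)) (hLN _)
    -- the floor's RP square is the normalisation square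
    change c₁ * Real.sqrt (refSquare r (βs (φ k)) (Ls (φ k)) δ₀ (m (βs (φ k)))) ^ 3 ≤
      σ * smearedThreePoint r (βs (φ k)) (Ls (φ k)) (m (βs (φ k))) φ₁ φ₂ φ₃ at hfl
    set N := refSquare r (βs (φ k)) (Ls (φ k)) δ₀ (m (βs (φ k))) with hNdef
    have hN := hNpos (φ k)
    have hsq : 0 < Real.sqrt N := Real.sqrt_pos.2 hN
    rw [hca, hschβ, hschL, hscha, mul_pow, ← pow_mul, mul_assoc, ← smearedThreePoint_eq_mul_Q3, abs_mul, abs_pow,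
      abs_inv, abs_of_pos hsq]
    have habs : σ * smearedThreePoint r (βs (φ k)) (Ls (φ k)) (m (βs (φ k))) φ₁ φ₂ φ₃ ≤
        |smearedThreePoint r (βs (φ k)) (Ls (φ k)) (m (βs (φ k))) φ₁ φ₂ φ₃| := by
      rcases hσ with h | h <;> rw [h] <;> simp [le_abs_self, neg_le_abs]
    have h3 : c₁ * Real.sqrt N ^ 3 ≤ |smearedThreePoint r (βs (φ k)) (Ls (φ k)) (m (βs (φ k))) φ₁ φ₂ φ₃| :=
      hfl.trans habs
    have hid : (Real.sqrt N)⁻¹ ^ 3 * (c₁ * Real.sqrt N ^ 3) = c₁ := by field_simp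
    rw [← hid]
    exact mul_le_mul_of_nonneg_left h3 (by positivity)
  have hNG' := nonGaussian_of_scaledQ3 G r sch.β sch.L sch.a (sch.c r.curvature) S₁ φ₁ φ₂ φ₃ c₁ hc₁ hd12 hd23 hd13
    hS₁1 (fun F hF => hD8 3 F hF) hfloorQ3
  /- 7. the uniform lattice gap at rate `1` -/
  have hgap1 : HasLatticeMassGap r sch 1 :=
    hasLatticeMassGap_of_allPairsDecay r β₁ m hii sch 1 (Eventually.of_forall fun k => by rw [hschβ]; exact hβ₁ _)
      (Eventually.of_forall fun k => by rw [hscha, hschβ, one_mul])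
  /- 8. assemble -/
  exact ⟨δ₀, sch, S₁, Spl, hδ₀, hSD, hPR, hE0, hE0', hE3, htrans, hconv, hNT, hNG', hgap1⟩

end Summit.QuantumFields.YangMills.Cruxes.HypercubicLimit.ConditionalMeanTelescoping

end
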